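import Literature.NumberTheory.Transcendental.KZCalculus
import Literature.NumberTheory.Transcendental.MultipleZeta
import HarnessLib
import Mathlib.Analysis.SpecialFunctions.Integrability.Basic
import Mathlib.MeasureTheory.Integral.Pi

/-!
# The iterated-integral (simplex) representation of a multiple zeta value

Trunk T-TRANSCEND (Literature/NumberTheory/Transcendental; requester hinted
Summits/KontsevichZagierPeriods/Theorems/MZV/ — filed as Literature since it carries named facts);
route Grothendieck (crux #3); definition request `wi-03649`
(`Literature.NumberTheory.Transcendental.KZ.mzvRep`).

For an admissible index `s = (s₁, …, s_k)` (all `sᵢ ≥ 1`, `s₁ ≥ 2`) of weight `w = Σ sᵢ`,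
Kontsevich's formula (Zagier 1994, §9; Kontsevich–Zagier 2001, §1.1; Brown 2012, §1) writes
`ζ(s₁, …, s_k) = ∫_{1 > t₁ > ⋯ > t_w > 0} ω_{ε₁}(t₁) ⋯ ω_{ε_w}(t_w) dt`, with `ω₀(t) = 1/t`,
`ω₁(t) = 1/(1 - t)`, and `ε = 0^{s₁-1} 1 0^{s₂-1} 1 ⋯ 0^{s_k-1} 1` the binary word of `s`
(convention `n₁ > n₂ > ⋯` of `Literature.NumberTheory.Transcendental.multipleZeta`). This exhibits `ζ(s)` as an effective period with
domain the open ordered simplex (a `ℚ`-semialgebraic set) and rational integrand.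

## Contents

* `MZV.binaryWord s : List Bool` (`false` = `0`, `true` = `1`) with `length = weight s`;
  `KZ.mzvForm`, `KZ.openOrderedSimplex w`, `KZ.mzvIntegrand s`;
* `KZ.isSemialgebraic_openOrderedSimplex` (PROVED: a finite intersection of strict polynomial
  inequalities);
* named facts for the analytic inputs: `KZ.mzvIntegrand_isSemialgebraicFunOn` (rational
  functions are semialgebraic; needs the tree's Tarski–Seidenberg-level facts) and
  `KZ.mzvIntegrand_integrableOn` (absolute convergence on the open simplex for admissible `s`);
  the latter is PROVED below (`KZ.mzvIntegrand_integrableOn_holds`: domination on the simplex by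
  the integrable product `∏ᵢ 2 (tᵢ^{-c} + (1 - tᵢ)^{-c})`, `c = 1 - 1/w`);
* `KZ.mzvRep s hs h₁ h₂ : IntegralRep (weight s)` — the representation, taking the two analytic
  inputs as hypotheses (feed the facts), and the named fact `KZ.mzvRep_value`:
  its value is `multipleZeta s` (Kontsevich's formula; the content of `isPeriod_multipleZeta`).
* NOT included (deferred to a separate item): `DoubleShuffleInKZ` — it needs the regularised
  double-shuffle relations of Ihara–Kaneko–Zagier 2006 written in `KZ.FormalRep`, i.e. a
  formalisation of the (quasi-)shuffle products and regularisation, which the tree lacks.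

## Sources

* D. Zagier, *Values of zeta functions and their applications*, ECM 1992 (Birkhäuser 1994), §9.
* M. Kontsevich, D. Zagier, *Periods* (2001), §1.1 (iterated-integral representation of MZVs).
* F. Brown, *Mixed Tate motives over ℤ*, Ann. Math. 175 (2012), §1.
-/

noncomputable section

open MeasureTheory Set MvPolynomial

namespace Literature.NumberTheory.Transcendental

namespace MZV

/-- The binary word `0^{s₁-1} 1 0^{s₂-1} 1 ⋯ 0^{s_k-1} 1` of an index (`false` = the letter `0`,
i.e. the form `dt/t`; `true` = the letter `1`, i.e. `dt/(1-t)`). [Zagier 1994, §9; Brown 2012, §1] [cite: Zagier1994, §9] -/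
def binaryWord : List ℕ → List Bool
  | [] => []
  | a :: s => List.replicate (a - 1) false ++ [true] ++ binaryWord s

/-- The binary word of an index with positive entries has length the weight.
[Zagier 1994, §9] [folklore] -/
theorem length_binaryWord {s : List ℕ} (hs : ∀ i ∈ s, 1 ≤ i) :
    (binaryWord s).length = weight s := by
  induction s with
  | nil => rfl
  | cons a s ih =>
    have ha : 1 ≤ a := hs a (by simp)
    have := ih fun i hi => hs i (by simp [hi])
    simp only [binaryWord, List.length_append, List.length_replicate, List.length_singleton,
      this, weight, List.sum_cons] at *
    omega

/-- For an admissible index the binary word has length the weight. [Zagier 1994, §9] [folklore] -/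
theorem IsAdmissible.length_binaryWord {s : List ℕ} (hs : IsAdmissible s) :
    (binaryWord s).length = weight s :=
  MZV.length_binaryWord hs.1

end MZV

namespace KZ

/-- The two differential forms of the iterated integral: `ω₀(t) = 1/t` (`ε = false`) and
`ω₁(t) = 1/(1 - t)` (`ε = true`). [Kontsevich–Zagier 2001, §1.1] [cite: KontsevichZagier2001, §1.1] -/
def mzvForm (ε : Bool) (t : ℝ) : ℝ :=
  if ε then 1 / (1 - t) else 1 / t

/-- The open ordered simplex `{t | 1 > t₀ > t₁ > ⋯ > t_{w-1} > 0} ⊆ ℝ^w`, the domain of the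
iterated integral. [Kontsevich–Zagier 2001, §1.1; Brown 2012, §1] [cite: KontsevichZagier2001, §1.1] -/
def openOrderedSimplex (w : ℕ) : Set (Fin w → ℝ) :=
  {t | (∀ i, 0 < t i) ∧ (∀ i, t i < 1) ∧ StrictAnti t}

/-- The integrand `∏ᵢ ω_{εᵢ}(tᵢ)` of Kontsevich's formula for the index `s` (letters read off the
binary word, index cast along `length_binaryWord`; the junk letter `false` is used beyond the
word, which does not happen for admissible `s`). [Kontsevich–Zagier 2001, §1.1; Zagier 1994, §9] [cite: KontsevichZagier2001, §1.1] -/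
def mzvIntegrand (s : List ℕ) (t : Fin (MZV.weight s) → ℝ) : ℝ :=
  ∏ i : Fin (MZV.weight s), mzvForm ((MZV.binaryWord s).getD i false) (t i)

/-- **The ordered open simplex is `ℚ`-semialgebraic**: it is the finite intersection of the
strict polynomial inequalities `tᵢ > 0`, `1 - tᵢ > 0`, `tᵢ - tⱼ > 0` (`i < j`).
[Kontsevich–Zagier 2001, §1.1; Bochnak–Coste–Roy 1998, Def. 2.1.4] [folklore] -/
theorem isSemialgebraic_openOrderedSimplex (w : ℕ) :
    Literature.ModelTheory.ExponentialFields.IsSemialgebraic ℚ (openOrderedSimplex w) := by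
  have h1 : Literature.ModelTheory.ExponentialFields.IsSemialgebraic ℚ {t : Fin w → ℝ | ∀ i, 0 < t i} := by
    have : {t : Fin w → ℝ | ∀ i, 0 < t i} = ⋂ i ∈ (Finset.univ : Finset (Fin w)),
        {t | 0 < aeval t (X i : MvPolynomial (Fin w) ℚ)} := by
      ext t; simp
    rw [this]
    exact Literature.ModelTheory.ExponentialFields.IsSemialgebraic.biInter _ _ fun i _ => Literature.ModelTheory.ExponentialFields.isSemialgebraic_setOf_eval_pos (k := ℚ) _
  have h2 : Literature.ModelTheory.ExponentialFields.IsSemialgebraic ℚ {t : Fin w → ℝ | ∀ i, t i < 1} := by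
    have : {t : Fin w → ℝ | ∀ i, t i < 1} = ⋂ i ∈ (Finset.univ : Finset (Fin w)),
        {t | 0 < aeval t (1 - X i : MvPolynomial (Fin w) ℚ)} := by
      ext t; simp [sub_pos]
    rw [this]
    exact Literature.ModelTheory.ExponentialFields.IsSemialgebraic.biInter _ _ fun i _ => Literature.ModelTheory.ExponentialFields.isSemialgebraic_setOf_eval_pos (k := ℚ) _
  have h3 : Literature.ModelTheory.ExponentialFields.IsSemialgebraic ℚ {t : Fin w → ℝ | StrictAnti t} := by
    have : {t : Fin w → ℝ | StrictAnti t} = ⋂ p ∈ (Finset.univ.filter fun p : Fin w × Fin w =>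
        p.1 < p.2), {t | 0 < aeval t (X p.1 - X p.2 : MvPolynomial (Fin w) ℚ)} := by
      ext t
      simp only [mem_setOf_eq, Finset.mem_filter, Finset.mem_univ, true_and, mem_iInter,
        map_sub, aeval_X, sub_pos, Prod.forall]
      exact ⟨fun h a b hab => h hab, fun h a b hab => h a b hab⟩
    rw [this]
    exact Literature.ModelTheory.ExponentialFields.IsSemialgebraic.biInter _ _ fun p _ => Literature.ModelTheory.ExponentialFields.isSemialgebraic_setOf_eval_pos (k := ℚ) _
  have : openOrderedSimplex w =
      {t | ∀ i, 0 < t i} ∩ {t | ∀ i, t i < 1} ∩ {t : Fin w → ℝ | StrictAnti t} := by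
    ext t; simp [openOrderedSimplex, and_assoc]
  rw [this]
  exact (h1.inter h2).inter h3

/-- **Fact (semialgebraic integrand).** The rational integrand `∏ ω_{εᵢ}(tᵢ)` is a
`ℚ`-semialgebraic function on the open simplex (its graph is cut out by
`y · ∏(denominators) = 1` on the simplex). [Bochnak–Coste–Roy 1998, Prop. 2.2.6 (rational
functions); Kontsevich–Zagier 2001, §1.1] [cite: KontsevichZagier2001, §1.1] -/
def mzvIntegrand_isSemialgebraicFunOn : Prop :=
  ∀ s : List ℕ, IsSemialgebraicFunOn ℚ (openOrderedSimplex (MZV.weight s)) (mzvIntegrand s)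

/-- **Fact (absolute convergence).** For an admissible index the iterated integral converges
absolutely on the open simplex (`s₁ ≥ 2` controls the singularity at `t₁ = 1`, positivity of the
integrand makes convergence absolute). [Zagier 1994, §9; Brown 2012, §1] [cite: Zagier1994, §9] -/
def mzvIntegrand_integrableOn : Prop :=
  ∀ s : List ℕ, MZV.IsAdmissible s →
    IntegrableOn (mzvIntegrand s) (openOrderedSimplex (MZV.weight s)) volume

/-- **`mzvRep s`**: the iterated-integral representation of `ζ(s)` as an effective period datum
(`KZ.IntegralRep`): domain the open ordered simplex in `ℝ^w`, integrand `∏ ω_{εᵢ}(tᵢ)`. The two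
analytic inputs (semialgebraicity of the integrand, absolute convergence) are hypotheses, to be
fed with the facts `mzvIntegrand_isSemialgebraicFunOn`, `mzvIntegrand_integrableOn`.
[Kontsevich–Zagier 2001, §1.1; Zagier 1994, §9; Brown 2012, §1] [cite: KontsevichZagier2001, §1.1] -/
def mzvRep (s : List ℕ) (_hs : MZV.IsAdmissible s)
    (h₁ : IsSemialgebraicFunOn ℚ (openOrderedSimplex (MZV.weight s)) (mzvIntegrand s))
    (h₂ : IntegrableOn (mzvIntegrand s) (openOrderedSimplex (MZV.weight s)) volume) :
    IntegralRep (MZV.weight s) where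
  domain := openOrderedSimplex (MZV.weight s)
  integrand := mzvIntegrand s
  isSemialgebraic_domain := isSemialgebraic_openOrderedSimplex _
  isSemialgebraicFunOn_integrand := h₁
  integrableOn := h₂

/-- **Kontsevich's formula** (named fact): the value of the simplex representation is the multiple
zeta value, `∫_{1>t₁>⋯>t_w>0} ∏ ω_{εᵢ}(tᵢ) dt = ζ(s₁, …, s_k)`. [Zagier 1994, §9;
Kontsevich–Zagier 2001, §1.1; Brown 2012, eq. (1.2)] [cite: KontsevichZagier2001, §1.1] -/
def mzvRep_value : Prop :=
  ∀ (s : List ℕ) (hs : MZV.IsAdmissible s)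
    (h₁ : IsSemialgebraicFunOn ℚ (openOrderedSimplex (MZV.weight s)) (mzvIntegrand s))
    (h₂ : IntegrableOn (mzvIntegrand s) (openOrderedSimplex (MZV.weight s)) volume),
    (mzvRep s hs h₁ h₂).value = multipleZeta s

/-! ### API -/

/-- The domain and integrand of `mzvRep`, unfolded. [folklore] -/
@[simp] theorem mzvRep_domain (s : List ℕ) (hs : MZV.IsAdmissible s) (h₁) (h₂) :
    (mzvRep s hs h₁ h₂).domain = openOrderedSimplex (MZV.weight s) := rfl

/-- The value of `mzvRep` is the integral over the simplex, unfolded. [folklore] -/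
theorem mzvRep_value_eq (s : List ℕ) (hs : MZV.IsAdmissible s) (h₁) (h₂) :
    (mzvRep s hs h₁ h₂).value = ∫ t in openOrderedSimplex (MZV.weight s), mzvIntegrand s t := rfl

/-- Example: the word of `ζ(2)` is `01` and of `ζ(2,1)`… of `(3, 1)` is `0011`. [Zagier 1994, §9] [folklore] -/
example : MZV.binaryWord [2] = [false, true] ∧ MZV.binaryWord [3, 1] = [false, false, true, true] :=
  ⟨rfl, rfl⟩

/-- The point `(1/2)` lies in the one-dimensional simplex `(0, 1)`. [folklore] -/
example : (fun _ => (1 / 2 : ℝ)) ∈ openOrderedSimplex 1 := by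
  refine ⟨fun _ => by norm_num, fun _ => by norm_num, fun i j h => ?_⟩
  exact absurd h (by omega)

/-! ### Discharge of `mzvIntegrand_isSemialgebraicFunOn`

The integrand `∏ᵢ ω_{εᵢ}(tᵢ)` is the reciprocal `1 / ∏ᵢ qᵢ(t)` of the polynomial
`∏ᵢ qᵢ ∈ ℚ[t₀, …, t_{w-1}]`, `qᵢ = tᵢ` (letter `0`) or `qᵢ = 1 - tᵢ` (letter `1`), whose zero set
misses the open simplex (`0 < tᵢ < 1` there); so it is a quotient of polynomials with
non-vanishing denominator on a `ℚ`-semialgebraic set, hence a `ℚ`-semialgebraic function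
(`isSemialgebraicFunOn_aeval_div_aeval`: the graph is `{y · ∏ qᵢ = 1}` over the simplex,
Bochnak–Coste–Roy 1998, §2.2 (Def. 2.2.5, Prop. 2.2.6 for rational functions);
Kontsevich–Zagier 2001, §1.1: "rational functions with rational coefficients"). -/

/-- The integrand of Kontsevich's formula is the reciprocal of the polynomial `∏ᵢ qᵢ`,
`qᵢ = Xᵢ` for the letter `0` and `qᵢ = 1 - Xᵢ` for the letter `1` (an identity of functions on
all of `ℝ^w`, with the junk value `1 / 0 = 0` on both sides).
[Kontsevich–Zagier 2001, §1.1] [cite: KontsevichZagier2001, §1.1] -/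
theorem mzvIntegrand_eq_aeval_div_aeval (s : List ℕ) (t : Fin (MZV.weight s) → ℝ) :
    mzvIntegrand s t = aeval t (1 : MvPolynomial (Fin (MZV.weight s)) ℚ) /
      aeval t (∏ i : Fin (MZV.weight s),
        (if (MZV.binaryWord s).getD i false then 1 - X i else X i :
          MvPolynomial (Fin (MZV.weight s)) ℚ)) := by
  simp only [mzvIntegrand, mzvForm, map_one, map_prod, one_div, ← Finset.prod_inv_distrib]
  refine Finset.prod_congr rfl fun i _ => ?_
  split_ifs <;> simp

/-- On the open ordered simplex the denominator `∏ᵢ qᵢ` of the integrand does not vanish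
(`0 < tᵢ < 1` for every coordinate). [Kontsevich–Zagier 2001, §1.1] [cite: KontsevichZagier2001, §1.1] -/
theorem aeval_prod_ne_zero_of_mem_openOrderedSimplex (s : List ℕ) {t : Fin (MZV.weight s) → ℝ}
    (ht : t ∈ openOrderedSimplex (MZV.weight s)) :
    aeval t (∏ i : Fin (MZV.weight s),
        (if (MZV.binaryWord s).getD i false then 1 - X i else X i :
          MvPolynomial (Fin (MZV.weight s)) ℚ)) ≠ 0 := by
  obtain ⟨h0, h1, -⟩ := ht
  rw [map_prod]
  refine Finset.prod_ne_zero_iff.mpr fun i _ => ?_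
  split_ifs
  · simpa [sub_eq_zero] using (h1 i).ne'
  · simpa using (h0 i).ne'

/-- **Discharge of `mzvIntegrand_isSemialgebraicFunOn`.** The rational integrand
`∏ᵢ ω_{εᵢ}(tᵢ) = 1 / ∏ᵢ qᵢ(t)` is a `ℚ`-semialgebraic function on the open ordered simplex: a
quotient of polynomials over `ℚ` whose denominator does not vanish on the (`ℚ`-semialgebraic)
simplex, its graph being cut out by `y · ∏ᵢ qᵢ(t) = 1` over the simplex.
[Bochnak–Coste–Roy 1998, §2.2 (Def. 2.2.5, Prop. 2.2.6); Kontsevich–Zagier 2001, §1.1]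
[cite: KontsevichZagier2001, §1.1] -/
theorem mzvIntegrand_isSemialgebraicFunOn_holds : mzvIntegrand_isSemialgebraicFunOn := by
  intro s
  refine (isSemialgebraicFunOn_aeval_div_aeval (isSemialgebraic_openOrderedSimplex _) 1 _
    fun t ht => aeval_prod_ne_zero_of_mem_openOrderedSimplex s ht).congr ?_
  intro t _
  exact (mzvIntegrand_eq_aeval_div_aeval s t).symm


/-! ### Discharge of `mzvIntegrand_integrableOn` (absolute convergence)

Zagier 1994, §9 (and Kontsevich–Zagier 2001, §1.1; Brown 2012, §1) state Kontsevich's formula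
for *admissible* indices, where the iterated integral converges. We prove the absolute
convergence directly by domination. The binary word of a nonempty admissible index starts with
the letter `0` (`s₁ ≥ 2`) and ends with the letter `1`; on the open simplex
`1 > t₀ > ⋯ > t_{w-1} > 0` one has, with `c = 1 - 1/w`,
`∏_{εᵢ = 0} tᵢ⁻¹ ≤ ∏ᵢ tᵢ^{-c}` (all `tᵢ ≤ 1`, the last letter is `1` and `t_{w-1}` is the smallest
coordinate) and symmetrically `∏_{εᵢ = 1} (1 - tᵢ)⁻¹ ≤ ∏ᵢ (1 - tᵢ)^{-c}` (the first letter is `0`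
and `1 - t₀` is the smallest); hence the integrand is dominated by
`∏ᵢ tᵢ^{-c} (1 - tᵢ)^{-c} ≤ ∏ᵢ 2 (tᵢ^{-c} + (1 - tᵢ)^{-c})`, a product of one-variable functions
integrable on `(0, 1)` because `c < 1`, which is integrable on the cube `(0,1)^w ⊇` simplex
(Fubini, `MeasureTheory.Integrable.fintype_prod`). -/

/-- `ω_ε(t) > 0` for `0 < t < 1`. [Kontsevich–Zagier 2001, §1.1] [folklore] -/
theorem mzvForm_pos (b : Bool) {x : ℝ} (h0 : 0 < x) (h1 : x < 1) : 0 < mzvForm b x := by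
  cases b <;> simp [mzvForm, h0, h1]

/-- The forms `ω_ε` are measurable functions on `ℝ`. [folklore] -/
theorem measurable_mzvForm (b : Bool) : Measurable fun t => mzvForm b t := by
  cases b
  · simp only [mzvForm, Bool.false_eq_true, ↓reduceIte, one_div]
    exact measurable_inv
  · simp only [mzvForm, ↓reduceIte, one_div]
    exact measurable_inv.comp (measurable_const.sub measurable_id)

/-- The open ordered simplex is an open subset of `ℝ^w`. [folklore] -/
theorem isOpen_openOrderedSimplex (w : ℕ) : IsOpen (openOrderedSimplex w) := by
  have h1 : IsOpen {t : Fin w → ℝ | ∀ i, 0 < t i} := by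
    rw [Set.setOf_forall]
    exact isOpen_iInter_of_finite fun i => isOpen_lt continuous_const (continuous_apply i)
  have h2 : IsOpen {t : Fin w → ℝ | ∀ i, t i < 1} := by
    rw [Set.setOf_forall]
    exact isOpen_iInter_of_finite fun i => isOpen_lt (continuous_apply i) continuous_const
  have h3 : IsOpen {t : Fin w → ℝ | StrictAnti t} := by
    have : {t : Fin w → ℝ | StrictAnti t} = ⋂ i, ⋂ j, ⋂ (_ : i < j), {t | t j < t i} := by
      ext t; simp [StrictAnti]
    rw [this]
    exact isOpen_iInter_of_finite fun i => isOpen_iInter_of_finite fun j =>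
      isOpen_iInter_of_finite fun _ => isOpen_lt (continuous_apply j) (continuous_apply i)
  have : openOrderedSimplex w =
      {t | ∀ i, 0 < t i} ∩ {t | ∀ i, t i < 1} ∩ {t : Fin w → ℝ | StrictAnti t} := by
    ext t; simp [openOrderedSimplex, and_assoc]
  rw [this]
  exact (h1.inter h2).inter h3

/-- The open ordered simplex is Lebesgue measurable. [folklore] -/
theorem measurableSet_openOrderedSimplex (w : ℕ) : MeasurableSet (openOrderedSimplex w) :=
  (isOpen_openOrderedSimplex w).measurableSet

/-- **Key inequality.** For `0 < uᵢ ≤ 1`, an index `j ∉ Z` at which `u` is minimal and an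
exponent `c ∈ [0, 1]` with `|Z| (1 - c) ≤ c`: `∏_{i ∈ Z} uᵢ⁻¹ ≤ ∏ᵢ uᵢ^{-c}`. (Proof:
`∏_Z uᵢ⁻¹ = ∏_Z uᵢ^{-c} · ∏_Z uᵢ^{c-1} ≤ ∏_Z uᵢ^{-c} · u_j^{|Z|(c-1)} ≤ ∏_Z uᵢ^{-c} · u_j^{-c}`.)
[folklore] -/
theorem prod_inv_le_prod_rpow {ι : Type*} [Fintype ι] (Z : Finset ι) (u : ι → ℝ) (j : ι)
    (hj : j ∉ Z) (hu0 : ∀ i, 0 < u i) (hu1 : ∀ i, u i ≤ 1) (hmin : ∀ i, u j ≤ u i)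
    {c : ℝ} (hc0 : 0 ≤ c) (hc1 : c ≤ 1) (hc : (Z.card : ℝ) * (1 - c) ≤ c) :
    ∏ i ∈ Z, (u i)⁻¹ ≤ ∏ i, u i ^ (-c) := by
  classical
  have hA : 0 ≤ ∏ i ∈ Z, u i ^ (-c) := Finset.prod_nonneg fun i _ => Real.rpow_nonneg (hu0 i).le _
  have h1 : ∏ i ∈ Z, (u i)⁻¹ = (∏ i ∈ Z, u i ^ (-c)) * ∏ i ∈ Z, u i ^ (c - 1) := by
    rw [← Finset.prod_mul_distrib]
    refine Finset.prod_congr rfl fun i _ => ?_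
    rw [← Real.rpow_add (hu0 i), ← Real.rpow_neg_one]
    congr 1; ring
  have h2 : ∏ i ∈ Z, u i ^ (c - 1) ≤ u j ^ (-c) := by
    calc ∏ i ∈ Z, u i ^ (c - 1) ≤ ∏ _i ∈ Z, u j ^ (c - 1) :=
          Finset.prod_le_prod (fun i _ => Real.rpow_nonneg (hu0 i).le _)
            fun i _ => Real.rpow_le_rpow_of_nonpos (hu0 j) (hmin i) (by linarith)
      _ = u j ^ ((Z.card : ℝ) * (c - 1)) := by
          rw [Finset.prod_const, ← Real.rpow_natCast, ← Real.rpow_mul (hu0 j).le, mul_comm]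
      _ ≤ u j ^ (-c) := Real.rpow_le_rpow_of_exponent_ge (hu0 j) (hu1 j) (by nlinarith)
  have h3 : u j ^ (-c) ≤ ∏ i ∈ Zᶜ, u i ^ (-c) := by
    rw [← Finset.mul_prod_erase _ _ (Finset.mem_compl.2 hj)]
    refine le_mul_of_one_le_right (Real.rpow_nonneg (hu0 j).le _) ?_
    exact Finset.one_le_prod fun i _ =>
      Real.one_le_rpow_of_pos_of_le_one_of_nonpos (hu0 i) (hu1 i) (by linarith)
  rw [h1, ← Finset.prod_mul_prod_compl Z]
  exact mul_le_mul_of_nonneg_left (h2.trans h3) hA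

/-- One-variable majorant: `x^{-c} (1 - x)^{-c} ≤ 2 (x^{-c} + (1 - x)^{-c})` for `x ∈ (0, 1)` and
`c ∈ [0, 1]` (one of the two factors is at most `2^c ≤ 2`). [folklore] -/
theorem rpow_neg_mul_one_sub_rpow_neg_le {c x : ℝ} (hc0 : 0 ≤ c) (hc1 : c ≤ 1)
    (hx0 : 0 < x) (hx1 : x < 1) :
    x ^ (-c) * (1 - x) ^ (-c) ≤ 2 * (x ^ (-c) + (1 - x) ^ (-c)) := by
  have h2 : (1 / 2 : ℝ) ^ (-c) ≤ 2 := by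
    rw [one_div, Real.inv_rpow (by norm_num), Real.rpow_neg (by norm_num), inv_inv]
    calc (2 : ℝ) ^ c ≤ 2 ^ (1 : ℝ) := Real.rpow_le_rpow_of_exponent_le (by norm_num) hc1
      _ = 2 := Real.rpow_one _
  have hA : 0 ≤ x ^ (-c) := Real.rpow_nonneg hx0.le _
  have hB : 0 ≤ (1 - x) ^ (-c) := Real.rpow_nonneg (by linarith) _
  rcases le_or_gt x (1 / 2) with hx | hx
  · have hB2 : (1 - x) ^ (-c) ≤ 2 :=
      (Real.rpow_le_rpow_of_nonpos (by norm_num) (by linarith) (by linarith)).trans h2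
    calc x ^ (-c) * (1 - x) ^ (-c) ≤ x ^ (-c) * 2 := mul_le_mul_of_nonneg_left hB2 hA
      _ ≤ 2 * (x ^ (-c) + (1 - x) ^ (-c)) := by linarith
  · have hA2 : x ^ (-c) ≤ 2 :=
      (Real.rpow_le_rpow_of_nonpos (by norm_num) hx.le (by linarith)).trans h2
    calc x ^ (-c) * (1 - x) ^ (-c) ≤ 2 * (1 - x) ^ (-c) := mul_le_mul_of_nonneg_right hA2 hB
      _ ≤ 2 * (x ^ (-c) + (1 - x) ^ (-c)) := by linarith

/-- The majorant `2 (x^{-c} + (1 - x)^{-c})` is integrable on `(0, 1)` for `c < 1` (two Beta-type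
integrals `∫₀¹ x^{-c} dx = ∫₀¹ (1-x)^{-c} dx = 1/(1-c)`). [folklore] -/
theorem integrableOn_Ioo_majorant {c : ℝ} (hc : c < 1) :
    IntegrableOn (fun x : ℝ => 2 * (x ^ (-c) + (1 - x) ^ (-c))) (Ioo 0 1) volume := by
  have h1 : IntervalIntegrable (fun x : ℝ => x ^ (-c)) volume 0 1 :=
    intervalIntegral.intervalIntegrable_rpow' (by linarith)
  have h2 : IntervalIntegrable (fun x : ℝ => (1 - x) ^ (-c)) volume 0 1 := by
    have := h1.comp_sub_left 1
    simp only [sub_zero, sub_self] at this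
    exact this.symm
  exact (intervalIntegrable_iff_integrableOn_Ioo_of_le zero_le_one).1 ((h1.add h2).const_mul 2)

/-- **Domination lemma.** For a word `ε` of length `w` whose first letter is `0` and whose last
letter is `1`, the integrand `∏ᵢ ω_{εᵢ}(tᵢ)` is integrable on the open ordered simplex.
[Zagier 1994, §9; Brown 2012, §1] [cite: Zagier1994, §9] -/
theorem integrableOn_prod_mzvForm (w : ℕ) (ε : ℕ → Bool)
    (hfirst : 0 < w → ε 0 = false) (hlast : 0 < w → ε (w - 1) = true) :
    IntegrableOn (fun t : Fin w → ℝ => ∏ i : Fin w, mzvForm (ε i) (t i))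
      (openOrderedSimplex w) volume := by
  rcases Nat.eq_zero_or_pos w with rfl | hw
  · -- `ℝ^0` is a point: `volume` is a Dirac mass and the integrand is the empty product `1`.
    have : IsFiniteMeasure (volume : Measure (Fin 0 → ℝ)) := by
      rw [volume_pi, Measure.pi_of_empty]; infer_instance
    simp only [Finset.univ_eq_empty, Finset.prod_empty]
    exact integrableOn_const
  obtain ⟨n, rfl⟩ : ∃ n, w = n + 1 := ⟨w - 1, by omega⟩
  have hfirst' : ε 0 = false := hfirst hw
  have hlast' : ε n = true := by simpa using hlast hw
  -- the exponent `c = n / (n + 1) = 1 - 1/w`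
  set c : ℝ := n / (n + 1) with hc_def
  have hn : (0 : ℝ) < n + 1 := by positivity
  have hc0 : 0 ≤ c := by positivity
  have hc1 : c < 1 := by rw [hc_def, div_lt_one hn]; linarith
  have h1c : 1 - c = 1 / (n + 1) := by rw [hc_def, one_sub_div hn.ne']; ring
  have hcard : ∀ (Z : Finset (Fin (n + 1))) (j : Fin (n + 1)), j ∉ Z →
      (Z.card : ℝ) * (1 - c) ≤ c := by
    intro Z j hj
    have hZ : Z ≠ Finset.univ := fun h => hj (h ▸ Finset.mem_univ j)
    have hlt : Z.card < n + 1 := by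
      simpa using Finset.card_lt_card (Finset.ssubset_univ_iff.mpr hZ)
    have hle : (Z.card : ℝ) ≤ n := by exact_mod_cast Nat.lt_succ_iff.mp hlt
    calc (Z.card : ℝ) * (1 - c) ≤ n * (1 - c) := mul_le_mul_of_nonneg_right hle (by linarith)
      _ = c := by rw [h1c, hc_def]; ring
  -- the dominating function: a product of one-variable integrable functions
  have hg : Integrable (fun t : Fin (n + 1) → ℝ =>
      ∏ i, (Ioo (0 : ℝ) 1).indicator (fun x : ℝ => 2 * (x ^ (-c) + (1 - x) ^ (-c))) (t i))
      (volume : Measure (Fin (n + 1) → ℝ)) := by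
    have hφ : Integrable
        ((Ioo (0 : ℝ) 1).indicator fun x : ℝ => 2 * (x ^ (-c) + (1 - x) ^ (-c))) volume :=
      (integrableOn_Ioo_majorant hc1).integrable_indicator measurableSet_Ioo
    exact Integrable.fintype_prod (μ := fun _ : Fin (n + 1) => (volume : Measure ℝ))
      (f := fun _ => (Ioo (0 : ℝ) 1).indicator fun x : ℝ => 2 * (x ^ (-c) + (1 - x) ^ (-c)))
      fun _ => hφ
  have hf : Measurable (fun t : Fin (n + 1) → ℝ => ∏ i : Fin (n + 1), mzvForm (ε i) (t i)) :=
    Finset.measurable_prod _ fun i _ => (measurable_mzvForm _).comp (measurable_pi_apply i)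
  refine Integrable.mono' hg.integrableOn hf.aestronglyMeasurable
    ((ae_restrict_mem (measurableSet_openOrderedSimplex _)).mono fun t ht => ?_)
  obtain ⟨ht0, ht1, hanti⟩ := ht
  have hnonneg : 0 ≤ ∏ i : Fin (n + 1), mzvForm (ε i) (t i) :=
    Finset.prod_nonneg fun i _ => (mzvForm_pos _ (ht0 i) (ht1 i)).le
  rw [Real.norm_of_nonneg hnonneg]
  simp only [mzvForm, one_div]
  rw [Finset.prod_ite]
  -- the two blocks of the integrand
  have hO : ∏ i ∈ Finset.univ.filter (fun i : Fin (n + 1) => ε i = true), (1 - t i)⁻¹ ≤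
      ∏ i, (1 - t i) ^ (-c) :=
    prod_inv_le_prod_rpow _ (fun i : Fin (n + 1) => 1 - t i) (0 : Fin (n + 1)) (by simp [hfirst'])
      (fun i => by linarith [ht1 i]) (fun i => by linarith [ht0 i])
      (fun i => by linarith [hanti.antitone (Fin.zero_le i)]) hc0 hc1.le (hcard _ (0 : Fin (n + 1)) (by simp [hfirst']))
  have hZ : ∏ i ∈ Finset.univ.filter (fun i : Fin (n + 1) => ¬ε i = true), (t i)⁻¹ ≤
      ∏ i, t i ^ (-c) :=
    prod_inv_le_prod_rpow _ t (Fin.last n) (by simp [hlast']) ht0 (fun i => (ht1 i).le)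
      (fun i => hanti.antitone (Fin.le_last i)) hc0 hc1.le (hcard _ (Fin.last n) (by simp [hlast']))
  calc (∏ i ∈ Finset.univ.filter (fun i : Fin (n + 1) => ε i = true), (1 - t i)⁻¹) *
        ∏ i ∈ Finset.univ.filter (fun i : Fin (n + 1) => ¬ε i = true), (t i)⁻¹
      ≤ (∏ i, (1 - t i) ^ (-c)) * ∏ i, t i ^ (-c) :=
        mul_le_mul hO hZ (Finset.prod_nonneg fun i _ => (inv_pos.2 (ht0 i)).le)
          (Finset.prod_nonneg fun i _ => Real.rpow_nonneg (by linarith [ht1 i]) _)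
    _ = ∏ i, t i ^ (-c) * (1 - t i) ^ (-c) := by rw [Finset.prod_mul_distrib, mul_comm]
    _ ≤ ∏ i, 2 * (t i ^ (-c) + (1 - t i) ^ (-c)) :=
        Finset.prod_le_prod (fun i _ => mul_nonneg (Real.rpow_nonneg (ht0 i).le _)
          (Real.rpow_nonneg (by linarith [ht1 i]) _))
          fun i _ => rpow_neg_mul_one_sub_rpow_neg_le hc0 hc1.le (ht0 i) (ht1 i)
    _ = ∏ i, (Ioo (0 : ℝ) 1).indicator (fun x : ℝ => 2 * (x ^ (-c) + (1 - x) ^ (-c))) (t i) :=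
        Finset.prod_congr rfl fun i _ => (Set.indicator_of_mem (Set.mem_Ioo.2 ⟨ht0 i, ht1 i⟩)
          (fun x : ℝ => 2 * (x ^ (-c) + (1 - x) ^ (-c)))).symm

/-- The binary word of a nonempty index ends with the letter `1`. [Zagier 1994, §9] [folklore] -/
theorem _root_.Literature.NumberTheory.Transcendental.MZV.exists_binaryWord_eq_append_true
    {s : List ℕ} (hs : s ≠ []) : ∃ l, MZV.binaryWord s = l ++ [true] := by
  induction s with
  | nil => exact (hs rfl).elim
  | cons a s ih =>
    by_cases h : s = []
    · subst h
      exact ⟨List.replicate (a - 1) false, by simp [MZV.binaryWord]⟩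
    · obtain ⟨l, hl⟩ := ih h
      exact ⟨List.replicate (a - 1) false ++ [true] ++ l, by simp [MZV.binaryWord, hl]⟩

/-- The binary word of an index with `s₁ ≥ 2` starts with the letter `0`. [Zagier 1994, §9]
[folklore] -/
theorem _root_.Literature.NumberTheory.Transcendental.MZV.getD_binaryWord_cons_zero {a : ℕ}
    {s : List ℕ} (ha : 2 ≤ a) : (MZV.binaryWord (a :: s)).getD 0 false = false := by
  rw [MZV.binaryWord, show a - 1 = (a - 2) + 1 by omega, List.replicate_succ]
  rfl

/-- **Discharge of `mzvIntegrand_integrableOn`** (absolute convergence of Kontsevich's iterated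
integral for admissible indices): the integrand `∏ᵢ ω_{εᵢ}(tᵢ)` is nonnegative on the open
simplex and dominated by the integrable product `∏ᵢ 2 (tᵢ^{-c} + (1 - tᵢ)^{-c})`,
`c = 1 - 1/w < 1` (`integrableOn_prod_mzvForm`), using that the word of a nonempty admissible
index starts with `0` (`s₁ ≥ 2`) and ends with `1`. [Zagier 1994, §9; Brown 2012, §1]
[cite: Zagier1994, §9] -/
theorem mzvIntegrand_integrableOn_holds : mzvIntegrand_integrableOn := by
  intro s hs
  refine integrableOn_prod_mzvForm (MZV.weight s) (fun k => (MZV.binaryWord s).getD k false)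
    (fun hw => ?_) (fun hw => ?_)
  · obtain ⟨a, s', rfl⟩ : ∃ a s', s = a :: s' := by
      cases s with
      | nil => simp at hw
      | cons a s' => exact ⟨a, s', rfl⟩
    exact MZV.getD_binaryWord_cons_zero (hs.2 (List.cons_ne_nil _ _))
  · have hne : s ≠ [] := by rintro rfl; simp at hw
    obtain ⟨l, hl⟩ := MZV.exists_binaryWord_eq_append_true hne
    have hw' : MZV.weight s = l.length + 1 := by rw [← hs.length_binaryWord, hl]; simp
    simp [hl, hw']

end KZ

end Literature.NumberTheory.Transcendental
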